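import Summits.BirchSwinnertonDyer.Rank1Residual.Additive.CongruentPartnerMainConjecture
import Summits.BirchSwinnertonDyer.Rank1Residual.Additive.GordRankOneKatoCertificateClass
import Summits.BirchSwinnertonDyer.Rank1Residual.Additive.ChiBranchLowerAscent
import Summits.BirchSwinnertonDyer.Rank1Residual.Additive.SemistableTwistTowerThree
import HarnessLib

/-!
# "X4 ROUTE G" on X4♯(G-ord) ∩ `I₀*` ∩ {`ρ̄_{E,p}` onto}, every odd `p`: the tame-branch MAIN
# CONJECTURE at `E` from Kato's divisibility + ONE unit coefficient at index `b` + the typed budget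
# bound `BudgetLeLambdaAt p W b` (or a congruent partner), and its Λ-adic LOWER output
# `ChiBranchLowerDivisibility[Odd]At W p` / `QuadraticBranchLowerDivisibilityAt V p`
# (team n1011, seat p10 gen 2, OWNERS row T-E3d FILE 2; skeleton `cells/n1011/skel/T-E3d.md`)

HONEST FRAMING (cell `b2b-bsdres`, run/shared/lean/b2b/bsd-rank1-residual/, verbatim in every
file): the goal of the cell is to DELETE the COMBINATION-SHAPED residual classes of the
Birch–Swinnerton-Dyer formula for ALL analytic-rank `≤ 1` elliptic curves over `ℚ` — "full BSD
formula for every rank `≤ 1` curve in class `C`" assembled STRICTLY from published theorems — so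
that the rank-`≤ 1` remainder becomes exactly the CONSTRUCTION-SHAPED classes, which are TYPED
(missing-input `Prop`s), NOT attempted. This is not "finishing BSD". Team n1011 (N10/N11: X4 ∧
`p = 3`): research route on the CONSTRUCTION-SHAPED class X4; prove what is provable now; no claim
beyond stated classes; census output = EVIDENCE / conjecture items, never a Literature fact;
X4♯(G-ord) stays CONSTRUCTION-SHAPED; RESIDUAL-MAP marks UNCHANGED; nothing is booked by this file.
ONE definition (the index-`b` certificate shape `BranchUnitCoeffAt`, nothing asserted) and theorems;
the named facts enter as HYPOTHESES (`hK` = the semistable half-eigenspace reading of Kato 2004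
Thm. 17.4 (3), `hmodD`); NO new named fact, NO conjecture node.

## What and why (ROUTE-2 II.10, K-E / K-OUT of the skeleton)

`CongruentPartnerMainConjecture.lean` (FILE 1) is the image-free core: `budgetSqueeze`,
`transferSqueezeGe`, `partnerPackage`. THIS FILE instantiates it on the (G)-ordinary defect-2 rows of
X4 with `ρ̄_{E,p}` onto — the rows where Kato's divisibility on the `ω^{(p−1)/2}`-branch of the good
ordinary twist `E♭ = E^{(p*)}` is available in the tree (additive-p2 gen 19's full-series brick
`isTorsion_and_exists_iota_eq_branch_of_katoComponent`; the `p`-adic tower of the twist from surj(p):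
Serre at `p ≥ 5`, p14's certificate-free tower at `p = 3`, packaged as `ClassX4Gord.towerSurj_of_surj`):
* `BranchUnitCoeffAt W p b` (§0, TYPED certificate shape, nothing asserted): for every good-ordinary
  twist model `V`, newform `f` and period ratio `ϖ` of the parity of `(p−1)/2`, the Néron-normalised
  branch `ϖ·B_{(p−1)/2}(f, α)` has a coefficient of `p`-adic norm `1` at index `b` — the index-`b`
  generalisation of additive-p2's `BranchUnitCertificateAt` (= constant term `0` ∧ index `1`);
* `ClassX4Gord.mainConjecture_of_katoHalf_of_coeff_of_le` (§1, per datum and per twist datum): Kato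
  half + the unit coefficient at index `b` + `b ≤ λ(X(E/ℚ_∞))` ⟹ `char_Λ X = (g)` with
  `ι g = C(u·ϖ)·B`, `μ = 0`, `λ = b`; class forms `…_of_coeffCert_of_budget` (K-F₀ budget) and
  `…_of_coeffCert_of_congruentPartner` (K-C′: `TorsionIso`, `CongruentLambdaShift … e`,
  `r₁ ≤ rank E₁(ℚ)`-type lower bound and `μ(X(E₁)) = 0` at the partner);
* K-OUT (§2): the Λ-adic LOWER inputs of team n1011 FOLLOW — `ChiBranchLowerDivisibilityAt W p` and
  `ChiBranchLowerDivisibilityOddAt W p` (p07's typed W-level inputs, both parities; the wrong parity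
  is vacuous), hence seat p10's twist-model conjecture `QuadraticBranchLowerDivisibilityAt V p` for
  EVERY model `V` of `E^{(p*)}` (p07's `TypeGOrd.forall_quadraticBranchLower_iff_…`) — on these rows
  and under these per-pair inputs the LOWER conjecture node is a THEOREM, and the existing `T = 0`
  consumers apply by name.
Binder honesty: `hK`, `hmodD` named facts; `Surj W p`, `ClassX4Gord W p`, `e = 2` class binders; the
unit coefficient (ENGINE value, two-engine rule), `BudgetLeLambdaAt` (EPW Cor 3.2.5 per curve),
`TorsionIso` / `CongruentLambdaShift` / the partner's rank and `μ` (per pair, instrument tier or typed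
schema) — EVIDENCE until certified; nothing booked; no class theorem closes a row by itself.

References: Kato 2004 Thm. 17.4 (3) [Kato2004Asterisque]; Emerton–Pollack–Weston 2006 §3
[EmertonPollackWeston2006]; Greenberg–Vatsal 2000 §2 [GreenbergVatsal2000]; Greenberg LNM 1716 §5
[GreenbergLNM1716]; Skinner–Urban 2014 Thm. 3.6.4 (shape of the LOWER node) [SkinnerUrban2014];
Mazur–Tate–Teitelbaum 1986 §I.13 [MazurTateTeitelbaum1986Invent]; Washington GTM 83 §13.2 [Washington1997].
-/

set_option autoImplicit false

noncomputable section

open scoped Classical MatrixGroups ModularForm NumberField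

open CongruenceSubgroup WeierstrassCurve NumberField Literature.NumberTheory.EllipticCurves
  Literature.NumberTheory.EllipticCurves.ModularForms
  Literature.NumberTheory.EllipticCurves.Rank1Residual
  Literature.NumberTheory.EllipticCurves.Rank1Residual.Typed
  Literature.NumberTheory.GaloisRepresentations
  Literature.NumberTheory.EllipticCurves.Wuthrich2014
  Literature.NumberTheory.EllipticCurves.GreenbergVatsal2000
  Summit.BirchSwinnertonDyer.Rank1Residual.AdditivePotMult
  Summit.BirchSwinnertonDyer.Rank1Residual.X1.MuLambda
  Summit.BirchSwinnertonDyer.Rank1Residual.X11a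
  Summit.BirchSwinnertonDyer.Rank1Residual.Iwasawa
  IsDedekindDomain

open Summit.BirchSwinnertonDyer.Rank1Residual.X1.CongruenceTransfer (TorsionIso CongruentLambdaShift)

namespace Summit.BirchSwinnertonDyer.Rank1Residual.Additive

/-! ### §0 The index-`b` certificate shape (typed; nothing asserted) -/

/-- **TYPED INPUT (certificate-shaped; nothing asserted): the Néron-normalised `ω^{(p−1)/2}`-branch of
the twist has a `p`-ADIC UNIT COEFFICIENT AT INDEX `b`.** For EVERY globally minimal `V` with
`C • V^{(p*)} = W` (`p* = (−1)^{⌊p/2⌋} p`; intended `V = E♭`), ordinary at `p`, every newform `f` of `V`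
and every `ϖ ∈ ℚ` with `ϖ·Ω_V = Ω⁺_f` (`p ≡ 1 (mod 4)`) resp. `ϖ·|Ω⁻_V| = Ω⁻_f` (`p ≡ 3 (mod 4)`):
`‖[T^b](ϖ · B_{(p−1)/2}(f, α_p(V)))‖_p = 1`. A finite `p`-adic computation per pair (first unit
index of the branch series = `λ_an`; ttrl2 W1 / ENG-D); additive-p2 gen 19's `BranchUnitCertificateAt`
is the case `b = 1` together with the constant-term vanishing. A predicate on `(W, p, b)`.
[cite: MazurTateTeitelbaum1986Invent, §I.13–I.14 (the branch series; nothing asserted)]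
[cite: SteinWuthrich2013, §4 (shape of such certificates)] -/
def BranchUnitCoeffAt (W : WeierstrassCurve ℚ) (p : ℕ) [Fact p.Prime] (b : ℕ) : Prop :=
  ∀ (V : WeierstrassCurve ℚ) [V.IsElliptic] [V.IsGloballyMinimal] (C : VariableChange ℚ),
    C • V.quadraticTwist ((-1 : ℚ) ^ (p / 2) * p) = W → IsOrdinaryAt V p →
    ∀ {N : ℕ} [NeZero N] (f : CuspForm (Gamma0 N) 2), IsNewformOf V f →
    ∀ ϖ : ℚ, (if Even (p / 2) then (ϖ : ℝ) * V.realPeriodRat = plusPeriod f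
        else (ϖ : ℝ) * V.imaginaryPeriodRat = minusPeriod f) →
      ‖PowerSeries.coeff b (PowerSeries.C (ϖ : ℚ_[p]) *
          (if Even (p / 2) then padicLFunctionBranch f ((unitRoot V p : ℤ_[p]) : ℚ_[p]) (p / 2)
            else padicLFunctionMinusBranch f ((unitRoot V p : ℤ_[p]) : ℚ_[p]) (p / 2)))‖ = 1

variable {W : WeierstrassCurve ℚ} [W.IsElliptic] [W.IsGloballyMinimal] {p : ℕ} [hp : Fact p.Prime]

/-! ### §1 The main conjecture on the branch, per datum -/

omit [W.IsElliptic] [W.IsGloballyMinimal] in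
/-- **Generators exist**: the characteristic ideal of a finitely generated torsion `Λ`-module is
principal (structure theorem; tree `exists_isPseudoIsomorphism_elementary_holds`,
`charIdeal_eq_span_holds`). [cite: Washington1997, §13.2] -/
theorem exists_charIdeal_eq_span {κ : ZpExtension ℚ p} {γ : Field.absoluteGaloisGroup ℚ}
    (D : W.SelmerDualData κ γ) [Module.Finite (IwasawaAlgebra p) D.X] (hX : D.IsTorsion) :
    ∃ fE : IwasawaAlgebra p, D.charIdeal = Ideal.span {fE} := by
  obtain ⟨μs, fs, -, hfs, hψ⟩ := exists_isPseudoIsomorphism_elementary_holds p D.X hX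
  exact ⟨charElement p μs fs, charIdeal_eq_span_holds p D.X (fun f hf ↦ (hfs f hf).1) hψ⟩

omit [W.IsGloballyMinimal] in
/-- **K-E, per datum (X4♯(G-ord) ∩ `I₀*`, tower of `E`, every odd `p`).** For `W` in X4♯(G-ord) with
`e_E(p) = 2` and `ρ̄_{E,pⁿ}` onto for all `n`, a globally minimal good-ordinary `V` with
`C • V^{(p*)} = W`, the cyclotomic data, the newform `f` of `V`, the period ratio `ϖ` of the parity of
`(p−1)/2`, and a finitely generated dual datum `D` of `Sel_{p^∞}(E/ℚ_∞)`: IF the Néron-normalised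
branch has a unit coefficient at index `b` AND `b ≤ λ(D.X)`, THEN `X` is torsion and the main
conjecture holds on the branch — `char_Λ X = (g)` for the Kato element `g`, `ι g = C(u·ϖ)·B_{(p−1)/2}`,
`u ∈ ℤ_pˣ` — with `μ(X) = 0` and `λ(X) = b`. Inputs: the half-eigenspace reading of Kato 17.4 (3)
(`hK`, via `…_of_surjective_of_half`), FILE 1's squeeze. [cite: Kato2004Asterisque, Thm. 17.4 (3) (p. 273)]
[cite: Washington1997, §13.2] -/
theorem ClassX4Gord.mainConjecture_of_katoHalf_of_coeff_of_le
    (hK : Wuthrich2014.kato_halfEigenCharIdeal_dvd_cyclotomicPrime_of_surjective)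
    (hX : ClassX4Gord W p) (htower : ∀ n : ℕ, W.HasSurjectiveModNGaloisRep (p ^ n : ℕ))
    (V : WeierstrassCurve ℚ) [V.IsElliptic] [V.IsGloballyMinimal]
    (hCW : ∃ C : VariableChange ℚ, C • V.quadraticTwist ((-1 : ℚ) ^ (p / 2) * p) = W)
    (hV : GoodOrd V p)
    {κ : ZpExtension ℚ p} {γ : Field.absoluteGaloisGroup ℚ} {N : ℕ} [NeZero N]
    {f : CuspForm (Gamma0 N) 2}
    (hκ : κ.IsCyclotomic) (hγ : κ.IsTopGenerator γ) (hcv : IsCyclotomicVariable p γ)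
    (hf : IsNewformOf V f) (D : W.SelmerDualData κ γ) [Module.Finite (IwasawaAlgebra p) D.X] (ϖ : ℚ)
    (hϖ : if Even (p / 2) then (ϖ : ℝ) * V.realPeriodRat = plusPeriod f
      else (ϖ : ℝ) * V.imaginaryPeriodRat = minusPeriod f)
    {b : ℕ}
    (hcoeff : ‖PowerSeries.coeff b (PowerSeries.C (ϖ : ℚ_[p]) *
        (if Even (p / 2) then padicLFunctionBranch f ((unitRoot V p : ℤ_[p]) : ℚ_[p]) (p / 2)
          else padicLFunctionMinusBranch f ((unitRoot V p : ℤ_[p]) : ℚ_[p]) (p / 2)))‖ = 1)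
    (hge : D.IsTorsion → D.mu = 0 → b ≤ lambdaInvariant p D.X) :
    D.IsTorsion ∧ ∃ (g : IwasawaAlgebra p) (u : ℤ_[p]ˣ), D.charIdeal = Ideal.span {g} ∧
      iwasawaToPowerSeries p g =
        PowerSeries.C (((u : ℤ_[p]) : ℚ_[p]) * (ϖ : ℚ_[p])) *
          (if Even (p / 2) then padicLFunctionBranch f ((unitRoot V p : ℤ_[p]) : ℚ_[p]) (p / 2)
            else padicLFunctionMinusBranch f ((unitRoot V p : ℤ_[p]) : ℚ_[p]) (p / 2)) ∧
      D.mu = 0 ∧ lambdaInvariant p D.X = b := by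
  have hp2 : p ≠ 2 := hX.addv.1
  have hpne : ((-1 : ℚ) ^ (p / 2) * p) ≠ 0 := pStar_ne_zero p
  have hj := padicValRat_j_nonneg_of_typeGOrd W p hX.typeGOrd
  have htowerV : ∀ n : ℕ, V.HasSurjectiveModNGaloisRep (p ^ n : ℕ) := fun n ↦
    (GaloisImage.hasSurjectiveModNGaloisRep_pow_iff_of_model_twist V p hpne hCW n).mp (htower n)
  obtain ⟨hXt, g, hg, u, hι⟩ := isTorsion_and_exists_iota_eq_branch_of_katoComponent W p
    (Kato2004.charIdeal_dvd_padicLFunctionBranch_component_of_surjective_of_half hK) hj hp2 V hCW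
    (Or.inl hV) htowerV hκ hγ hcv hf D ϖ hϖ
  obtain ⟨hgc, hlam⟩ := hasUnitContent_and_lam_le_of_iota_eq_of_norm_coeff_eq_one hι hcoeff
  obtain ⟨fE, hchar⟩ := exists_charIdeal_eq_span D hXt
  have hdvd : fE ∣ g := by
    rw [hchar] at hg
    exact Ideal.mem_span_singleton.mp hg
  have hmu : D.mu = 0 := mu_zero_of_charIdeal_eq_span_of_dvd D hXt hchar hgc hdvd
  obtain ⟨hspan, -, hlamD⟩ := span_eq_and_mu_zero_and_lambda_eq_of_dvd_of_lam_le_of_le D hXt hchar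
    hgc hdvd hlam (hge hXt hmu)
  exact ⟨hXt, g, u, hchar.trans hspan.symm, hι, hmu, hlamD⟩

/-- **K-E with the BUDGET (class form; partner-free).** X4♯(G-ord) ∩ `I₀*` ∩ {`ρ̄_{E,p}` onto},
every odd `p` (tower from surj by `ClassX4Gord.towerSurj_of_surj`): Kato half + `BranchUnitCoeffAt W p b`
+ `BudgetLeLambdaAt p W b` ⟹ for the cyclotomic data, EVERY good-ordinary twist model / newform / period
ratio and every dual datum: `X` torsion, `char_Λ X = (g)` with `ι g = C(u·ϖ)·B`, `μ = 0`, `λ = b`.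
[cite: Kato2004Asterisque, Thm. 17.4 (3) (p. 273)] [cite: EmertonPollackWeston2006, Cor. 3.2.5 and Thm. 3.1.1 (source of the budget input)] -/
theorem ClassX4Gord.mainConjecture_of_katoHalf_of_coeffCert_of_budget
    (hK : Wuthrich2014.kato_halfEigenCharIdeal_dvd_cyclotomicPrime_of_surjective)
    (hX : ClassX4Gord W p) (he : semistabilityIndex W p = 2) (hsurj : Surj W p)
    {b : ℕ} (hcert : BranchUnitCoeffAt W p b) (hbud : BudgetLeLambdaAt p W b)
    (V : WeierstrassCurve ℚ) [V.IsElliptic] [V.IsGloballyMinimal] (C : VariableChange ℚ)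
    (hC : C • V.quadraticTwist ((-1 : ℚ) ^ (p / 2) * p) = W) (hV : GoodOrd V p)
    {κ : ZpExtension ℚ p} {γ : Field.absoluteGaloisGroup ℚ} {N : ℕ} [NeZero N]
    {f : CuspForm (Gamma0 N) 2}
    (hκ : κ.IsCyclotomic) (hγ : κ.IsTopGenerator γ) (hcv : IsCyclotomicVariable p γ)
    (hf : IsNewformOf V f) (D : W.SelmerDualData κ γ) (ϖ : ℚ)
    (hϖ : if Even (p / 2) then (ϖ : ℝ) * V.realPeriodRat = plusPeriod f
      else (ϖ : ℝ) * V.imaginaryPeriodRat = minusPeriod f) :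
    D.IsTorsion ∧ ∃ (g : IwasawaAlgebra p) (u : ℤ_[p]ˣ), D.charIdeal = Ideal.span {g} ∧
      iwasawaToPowerSeries p g =
        PowerSeries.C (((u : ℤ_[p]) : ℚ_[p]) * (ϖ : ℚ_[p])) *
          (if Even (p / 2) then padicLFunctionBranch f ((unitRoot V p : ℤ_[p]) : ℚ_[p]) (p / 2)
            else padicLFunctionMinusBranch f ((unitRoot V p : ℤ_[p]) : ℚ_[p]) (p / 2)) ∧
      D.mu = 0 ∧ lambdaInvariant p D.X = b := by
  haveI : Module.Finite (IwasawaAlgebra p) D.X :=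
    SelmerDualData.module_finite_of_isCyclotomic (W := W) (κ := κ) hκ D hγ
  have hord : IsOrdinaryAt V p := isOrdinaryAt_of_goodOrd_or_mult_of_model_twist W V (pStar_ne_zero p)
    ⟨C, hC⟩ (padicValRat_j_nonneg_of_typeGOrd W p hX.typeGOrd) (Or.inl hV)
  exact hX.mainConjecture_of_katoHalf_of_coeff_of_le hK (hX.towerSurj_of_surj he hsurj) V ⟨C, hC⟩ hV hκ
    hγ hcv hf D ϖ hϖ (hcert V C hC hord f hf ϖ hϖ) (fun hXt hmu ↦ hbud hκ hγ hcv D hXt hmu)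

/-- **K-E with a CONGRUENT PARTNER (class form).** Same rows; instead of the budget: `E[p] ≅ E₁[p]`
(`TorsionIso`), the typed λ-shift `CongruentLambdaShift W W₁ p e` (EPW Thm 3.3.3 per pair), and at
the partner a torsion dual datum with `μ = 0` and `r₁ ≤ λ(X(E₁))` (e.g. from `r₁ ≤ rank E₁(ℚ)`,
FILE 1 `le_lambdaInvariant_of_le_mordellWeilRank`); the certificate at `E` sits at index `r₁ + e`.
Conclusion: MC on the branch at `E` with `λ(X(E)) = r₁ + e`, and `λ(X(E₁)) = r₁`.
READING OF RECORD for the schema (referee 1 ACK-1 proviso P1, 2026-08-21): per additive pair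
EPW 2006 Thm. 3.3.3 is applied in its `ω^i`-form (LIT-INPUTS-P3 §11.1, arXiv math/0404484 p0019
L147–166) on the HIDA FAMILY of `ρ̄_{E♭}` — the `p`-ordinary twist model — at `i = (p−1)/2`, NEVER
on `f_E` itself (`a_p(E) = 0`); `e = B(E,p) − B(E₁,p)`, `b = B(E,p)` the `p`-Tamagawa budget (P2).
[cite: Kato2004Asterisque, Thm. 17.4 (3) (p. 273)] [cite: EmertonPollackWeston2006, Thm. 3.3.3 (source of the schema)]
[cite: GreenbergVatsal2000, §2 Prop. (2.8), Cor. (2.3)] -/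
theorem ClassX4Gord.mainConjecture_of_katoHalf_of_coeffCert_of_congruentPartner
    (hK : Wuthrich2014.kato_halfEigenCharIdeal_dvd_cyclotomicPrime_of_surjective)
    (hX : ClassX4Gord W p) (he : semistabilityIndex W p = 2) (hsurj : Surj W p)
    {W₁ : WeierstrassCurve ℚ} [W₁.IsElliptic] [W₁.IsGloballyMinimal] {r₁ b : ℕ} {e : ℤ}
    (hiso : TorsionIso W W₁ p) (hG : CongruentLambdaShift W W₁ p e) (hb : (b : ℤ) = r₁ + e)
    (hcert : BranchUnitCoeffAt W p b)
    (V : WeierstrassCurve ℚ) [V.IsElliptic] [V.IsGloballyMinimal] (C : VariableChange ℚ)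
    (hC : C • V.quadraticTwist ((-1 : ℚ) ^ (p / 2) * p) = W) (hV : GoodOrd V p)
    {κ : ZpExtension ℚ p} {γ : Field.absoluteGaloisGroup ℚ} {N : ℕ} [NeZero N]
    {f : CuspForm (Gamma0 N) 2}
    (hκ : κ.IsCyclotomic) (hγ : κ.IsTopGenerator γ) (hcv : IsCyclotomicVariable p γ)
    (hf : IsNewformOf V f) (D : W.SelmerDualData κ γ) (D₁ : W₁.SelmerDualData κ γ)
    [Module.Finite (IwasawaAlgebra p) D₁.X] (hX₁ : D₁.IsTorsion) (hmu₁ : D₁.mu = 0)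
    (hr₁ : r₁ ≤ lambdaInvariant p D₁.X) (ϖ : ℚ)
    (hϖ : if Even (p / 2) then (ϖ : ℝ) * V.realPeriodRat = plusPeriod f
      else (ϖ : ℝ) * V.imaginaryPeriodRat = minusPeriod f) :
    (D.IsTorsion ∧ ∃ (g : IwasawaAlgebra p) (u : ℤ_[p]ˣ), D.charIdeal = Ideal.span {g} ∧
      iwasawaToPowerSeries p g =
        PowerSeries.C (((u : ℤ_[p]) : ℚ_[p]) * (ϖ : ℚ_[p])) *
          (if Even (p / 2) then padicLFunctionBranch f ((unitRoot V p : ℤ_[p]) : ℚ_[p]) (p / 2)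
            else padicLFunctionMinusBranch f ((unitRoot V p : ℤ_[p]) : ℚ_[p]) (p / 2)) ∧
      D.mu = 0 ∧ lambdaInvariant p D.X = b) ∧ lambdaInvariant p D₁.X = r₁ := by
  haveI : Module.Finite (IwasawaAlgebra p) D.X :=
    SelmerDualData.module_finite_of_isCyclotomic (W := W) (κ := κ) hκ D hγ
  have hp2 : p ≠ 2 := hX.addv.1
  have hpne : ((-1 : ℚ) ^ (p / 2) * p) ≠ 0 := pStar_ne_zero p
  have hj := padicValRat_j_nonneg_of_typeGOrd W p hX.typeGOrd
  have hord : IsOrdinaryAt V p :=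
    isOrdinaryAt_of_goodOrd_or_mult_of_model_twist W V hpne ⟨C, hC⟩ hj (Or.inl hV)
  have htowerV : ∀ n : ℕ, V.HasSurjectiveModNGaloisRep (p ^ n : ℕ) := fun n ↦
    (GaloisImage.hasSurjectiveModNGaloisRep_pow_iff_of_model_twist V p hpne ⟨C, hC⟩ n).mp
      (hX.towerSurj_of_surj he hsurj n)
  obtain ⟨hXt, g, hg, u, hι⟩ := isTorsion_and_exists_iota_eq_branch_of_katoComponent W p
    (Kato2004.charIdeal_dvd_padicLFunctionBranch_component_of_surjective_of_half hK) hj hp2 V ⟨C, hC⟩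
    (Or.inl hV) htowerV hκ hγ hcv hf D ϖ hϖ
  obtain ⟨hgc, hlam⟩ :=
    hasUnitContent_and_lam_le_of_iota_eq_of_norm_coeff_eq_one hι (hcert V C hC hord f hf ϖ hϖ)
  obtain ⟨fE, hchar⟩ := exists_charIdeal_eq_span D hXt
  have hdvd : fE ∣ g := by
    rw [hchar] at hg
    exact Ideal.mem_span_singleton.mp hg
  obtain ⟨hspan, hmu, hlamD, hlam₁⟩ := transferSqueezeGe p W W₁ hiso hG hκ hγ hcv D D₁ hXt hX₁ hmu₁
    hr₁ hchar hgc hdvd (by rw [← hb]; exact_mod_cast hlam)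
  refine ⟨⟨hXt, g, u, hchar.trans hspan.symm, hι, hmu, ?_⟩, hlam₁⟩
  have : (lambdaInvariant p D.X : ℤ) = b := by rw [hb]; exact hlamD
  exact_mod_cast this

/-! ### §2 K-OUT: the Λ-adic LOWER inputs of team n1011 follow (both parities) -/

omit [W.IsElliptic] [W.IsGloballyMinimal] in
/-- From `char_Λ X = (g)` with `ι g = C(u·ϖ)·B`: EVERY element of `char_Λ X` is, in `ℚ_p⟦T⟧`, a
`Λ`-multiple of `ϖ·B`. [folklore] -/
theorem forall_mem_charIdeal_exists_iota_eq_mul {κ : ZpExtension ℚ p} {γ : Field.absoluteGaloisGroup ℚ}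
    (D : W.SelmerDualData κ γ) {g : IwasawaAlgebra p} {u : ℤ_[p]ˣ} {ϖ : ℚ} {B : PowerSeries ℚ_[p]}
    (hchar : D.charIdeal = Ideal.span {g})
    (hι : iwasawaToPowerSeries p g = PowerSeries.C (((u : ℤ_[p]) : ℚ_[p]) * (ϖ : ℚ_[p])) * B) :
    ∀ g' ∈ D.charIdeal, ∃ h : IwasawaAlgebra p,
      iwasawaToPowerSeries p g' = iwasawaToPowerSeries p h * (PowerSeries.C ((ϖ : ℚ) : ℚ_[p]) * B) := by
  intro g' hg'
  rw [hchar] at hg'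
  obtain ⟨a, rfl⟩ := Ideal.mem_span_singleton'.mp hg'
  refine ⟨PowerSeries.C (u : ℤ_[p]) * a, ?_⟩
  rw [map_mul, hι, iwasawaToPowerSeries_C_mul', map_mul]
  ring

/-- **K-OUT, `p ≡ 1 (mod 4)`: `ChiBranchLowerDivisibilityAt W p`** (p07's W-level Λ-adic LOWER
input) on X4♯(G-ord) ∩ `I₀*` ∩ {`ρ̄` onto}, GIVEN Kato half + `BranchUnitCoeffAt W p b` +
`BudgetLeLambdaAt p W b`. [cite: Kato2004Asterisque, Thm. 17.4 (3) (p. 273)]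
[cite: SkinnerUrban2014, Thm. 3.6.4 (p. 43) (shape of the node; nothing of SU is used)] -/
theorem ClassX4Gord.chiBranchLowerDivisibilityAt_of_katoHalf_of_coeffCert_of_budget
    (hK : Wuthrich2014.kato_halfEigenCharIdeal_dvd_cyclotomicPrime_of_surjective)
    (hX : ClassX4Gord W p) (he : semistabilityIndex W p = 2) (hsurj : Surj W p)
    {b : ℕ} (hcert : BranchUnitCoeffAt W p b) (hbud : BudgetLeLambdaAt p W b) :
    ChiBranchLowerDivisibilityAt W p := by
  intro V _ _ κ γ N _ f hp1 hCW hV hκ hγ hcv hf D ϖ hϖ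
  have heven : Even (p / 2) := ⟨p / 4, by omega⟩
  obtain ⟨C, hC⟩ := hCW
  have hC' : C • V.quadraticTwist ((-1 : ℚ) ^ (p / 2) * p) = W := by
    rw [pStar_eq_of_mod_four p (Or.inl hp1), if_pos hp1]; exact hC
  have hϖ' : (if Even (p / 2) then (ϖ : ℝ) * V.realPeriodRat = plusPeriod f
      else (ϖ : ℝ) * V.imaginaryPeriodRat = minusPeriod f) := by rw [if_pos heven]; exact hϖ
  obtain ⟨-, g, u, hchar, hι, -, -⟩ := hX.mainConjecture_of_katoHalf_of_coeffCert_of_budget hK he hsurj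
    hcert hbud V C hC' hV hκ hγ hcv hf D ϖ hϖ'
  rw [if_pos heven] at hι
  exact forall_mem_charIdeal_exists_iota_eq_mul D hchar hι

/-- **K-OUT, `p ≡ 3 (mod 4)` (`p = 3` included): `ChiBranchLowerDivisibilityOddAt W p`** on
X4♯(G-ord) ∩ `I₀*` ∩ {`ρ̄` onto}, GIVEN Kato half + `BranchUnitCoeffAt W p b` + `BudgetLeLambdaAt p W b`.
[cite: Kato2004Asterisque, Thm. 17.4 (3) (p. 273)]
[cite: SkinnerUrban2014, Thm. 3.6.4 (p. 43) (shape of the node; nothing of SU is used)] -/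
theorem ClassX4Gord.chiBranchLowerDivisibilityOddAt_of_katoHalf_of_coeffCert_of_budget
    (hK : Wuthrich2014.kato_halfEigenCharIdeal_dvd_cyclotomicPrime_of_surjective)
    (hX : ClassX4Gord W p) (he : semistabilityIndex W p = 2) (hsurj : Surj W p)
    {b : ℕ} (hcert : BranchUnitCoeffAt W p b) (hbud : BudgetLeLambdaAt p W b) :
    ChiBranchLowerDivisibilityOddAt W p := by
  intro V _ _ κ γ N _ f hp3 hCW hV hκ hγ hcv hf D ϖ hϖ
  have hodd : ¬ Even (p / 2) := by rw [Nat.not_even_iff_odd]; exact ⟨p / 4, by omega⟩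
  obtain ⟨C, hC⟩ := hCW
  have hC' : C • V.quadraticTwist ((-1 : ℚ) ^ (p / 2) * p) = W := by
    rw [pStar_eq_of_mod_four p (Or.inr hp3), if_neg (by omega)]; exact hC
  have hϖ' : (if Even (p / 2) then (ϖ : ℝ) * V.realPeriodRat = plusPeriod f
      else (ϖ : ℝ) * V.imaginaryPeriodRat = minusPeriod f) := by rw [if_neg hodd]; exact hϖ
  obtain ⟨-, g, u, hchar, hι, -, -⟩ := hX.mainConjecture_of_katoHalf_of_coeffCert_of_budget hK he hsurj
    hcert hbud V C hC' hV hκ hγ hcv hf D ϖ hϖ'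
  rw [if_neg hodd] at hι
  exact forall_mem_charIdeal_exists_iota_eq_mul D hchar hι

/-- **K-OUT, twist-model form: seat p10's conjecture node `QuadraticBranchLowerDivisibilityAt V p` is
a THEOREM for EVERY model `V` of `E^{(p*)}`** on these rows, given Kato half + the index-`b` certificate
+ the budget (p07 g2's ascent/descent `TypeGOrd.forall_quadraticBranchLower_iff_…`).
[cite: Kato2004Asterisque, Thm. 17.4 (3) (p. 273)] [cite: GreenbergLNM1716, §5 (PDF p. 143)] -/
theorem ClassX4Gord.quadraticBranchLowerDivisibilityAt_of_katoHalf_of_coeffCert_of_budget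
    (hK : Wuthrich2014.kato_halfEigenCharIdeal_dvd_cyclotomicPrime_of_surjective)
    (hX : ClassX4Gord W p) (he : semistabilityIndex W p = 2) (hsurj : Surj W p)
    {b : ℕ} (hcert : BranchUnitCoeffAt W p b) (hbud : BudgetLeLambdaAt p W b)
    (V : WeierstrassCurve ℚ) [V.IsElliptic] [V.IsGloballyMinimal]
    (hCW : ∃ C : VariableChange ℚ, C • V.quadraticTwist ((-1) ^ (p / 2) * p : ℚ) = W) :
    QuadraticBranchLowerDivisibilityAt V p :=
  (TypeGOrd.forall_quadraticBranchLower_iff_chiBranchLowerDivisibility_and_odd W p hX.addv.1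
      hX.typeGOrd).mpr
    ⟨hX.chiBranchLowerDivisibilityAt_of_katoHalf_of_coeffCert_of_budget hK he hsurj hcert hbud,
      hX.chiBranchLowerDivisibilityOddAt_of_katoHalf_of_coeffCert_of_budget hK he hsurj hcert hbud⟩
    V hCW

end Summit.BirchSwinnertonDyer.Rank1Residual.Additive

end
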